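import Summits.ResolutionOfSingularities.ResolutionOfSingularities.Theorems.WeightedInvariantELadderTwoStage
import Summits.ResolutionOfSingularities.ResolutionOfSingularities.Theorems.WeightedInvariantELadderOneOrbitOfDim
import Summits.ResolutionOfSingularities.ResolutionOfSingularities.Theorems.WeightedInvariantELadderOneDisjoint
import Summits.ResolutionOfSingularities.ResolutionOfSingularities.Theorems.WeightedInvariantGradedSimpleOrbitCharts
import Summits.ResolutionOfSingularities.ResolutionOfSingularities.Theorems.WeightedInvariantHomogeneousMinimalPrimes
import Literature.AlgebraicGeometry.Resolution.AffineChartFibres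
import Literature.AlgebraicGeometry.Resolution.MaximalPoints
import HarnessLib

/-!
# Rung `e = 2`: ORBIT-GENERIC POINTS, intrinsically — the maximal points of the fibres of `q` over closed points

Route `ResolutionOfSingularities/WeightedInvariant`, door crux `HypersurfaceCentreConstruction`
(stmt-ResolutionOfSingularities-19897), E2 tier, piece (C-a) `E2MaxNonemptyBody` of the registrar's SPEC (Δ9)
(`L/res-L1-w43-plan-1/E2Step_split_sketch.lean` rev 3, ORDER (o47-a) dealt to res-D-pv-031).  Everything here is
OURS bookkeeping of the e-ladder; nothing is a statement of [Hironaka2017]; AI-written, weaker than expert review.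

`Stage.IsOrbitGeneric S η` (…ELadderTwoStage) asks, on EVERY unit chart `W a ∋ η` of the graded atlas, that the
prime `𝔭_a(η)` of `Γ(Y, W a)` be homogeneous with GRADED-SIMPLE quotient.  This file gives the chart-free way to
produce such points: **if `v := q x` is a CLOSED point of the quotient `V` and `η = i x` is a MAXIMAL point of the
fibre `i(q⁻¹{v}) ⊆ Y`, then `η` is orbit-generic** (`isOrbitGeneric_of_mem_maxPoints_fibre`).  On a chart `a`
with `v ∈ U a`:

* `fibreIdeal S a hv` — the ideal `J_a(v) ⊆ Γ(Y, W a)` of sections whose restriction to `X ∩ W a = q⁻¹(U a)` lies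
  in the extension `𝔪_v · Γ(X, X ∩ W a)` of the maximal ideal of `v`; it is HOMOGENEOUS
  (`isHomogeneous_fibreIdeal`: `= 𝓘(X)(W a) + (degree-0 lifts of 𝔪_v)`, by the atlas axioms `exists_lift`,
  `isHomogeneous_ker`);
* `fibreIdeal_le_primeIdealOf_iff` — for `x ∈ X ∩ W a`: `J_a(v) ≤ 𝔭_a(i x) ↔ q x = v`
  (`Literature…AffineChartFibres.apply_fromSpec_eq_iff_map_le` read through the surjection
  `Γ(Y, W a) → Γ(X, X ∩ W a)`); hence `Spec Γ(Y, W a) ×_Y i(q⁻¹{v}) = V(J_a(v))`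
  (`fromSpec_preimage_image_fibre`) and the prime of a maximal point of the (closed) fibre is a MINIMAL prime of
  `J_a(v)`, so HOMOGENEOUS (`isHomogeneous_primeIdealOf_of_mem_maxPoints_fibre`, via
  `Theorems.isHomogeneous_of_mem_minimalPrimes`);
* `isUnit_quotient_mk_of_degreeZero_of_fibreIdeal_le` — modulo a proper ideal `P ⊇ J_a(v)` every degree-`0`
  section off `P` is a unit (degree `0` descends to `Γ(V, U a)` by `exists_preimage`, and `𝔪_v` is maximal);
  with the unit-chart units (`exists_isUnit_quotient_of_isUnitChart`) res-type-047's criterion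
  `gradedSimple_of_degreeZero_of_units` gives graded-simplicity.

[folklore: Hartshorne II.3 (fibres), Bruns–Herzog §1.5 (graded rings); the torus reading: the fibre of the
good quotient over a closed point is a finite union of closed orbits of dimension `j`.]
-/

noncomputable section

set_option linter.dupNamespace false -- mandated namespace of this single-conjunct summit

open CategoryTheory AlgebraicGeometry TopologicalSpace
open Literature.AlgebraicGeometry.Resolution
open Summit.ResolutionOfSingularities.ResolutionOfSingularities.Theorems

namespace Summit.ResolutionOfSingularities.ResolutionOfSingularities.Theorems.ELadderOne.Stage

variable {k : Type} [Field k] (S : Stage k)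

/-! ## The chart `X ∩ W a` over `U a` -/

/-- `X ∩ W a = i⁻¹(W a)` is an affine open of `X` (`i` is a closed immersion, hence affine). [folklore] -/
theorem isAffineOpen_preimage_W (a : S.atlas.ι) : IsAffineOpen (S.i ⁻¹ᵁ (S.atlas.W a : S.Y.Opens)) :=
  (S.atlas.W a).2.preimage S.i

/-- A point of `X ∩ W a` maps to `U a` under `q` (`X ∩ W a = q⁻¹(U a)`). [folklore] -/
theorem base_mem_U (a : S.atlas.ι) {x : S.X} (hx : S.i.base x ∈ (S.atlas.W a : S.Y.Opens)) :
    S.q.base x ∈ (S.atlas.U a : S.V.Opens) := by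
  have h : x ∈ S.i ⁻¹ᵁ (S.atlas.W a : S.Y.Opens) := hx
  rw [S.atlas.preimage_eq a] at h
  exact h

/-! ## The fibre ideal of a point of the quotient chart -/

/-- **The fibre ideal** `J_a(v) ⊆ Γ(Y, W a)` of a point `v ∈ U a` of the quotient: the sections of the ambient
chart whose restriction to `X ∩ W a` lies in the extension of the prime `𝔭_{U a}(v)` of `Γ(V, U a)` along
`q♯ : Γ(V, U a) → Γ(X, X ∩ W a)`. [folklore] -/
def fibreIdeal (a : S.atlas.ι) {v : S.V} (hv : v ∈ (S.atlas.U a : S.V.Opens)) : Ideal Γ(S.Y, S.atlas.W a) :=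
  ((((S.atlas.U a).2.primeIdealOf ⟨v, hv⟩).asIdeal.map
      (S.q.appLE (S.atlas.U a) (S.i ⁻¹ᵁ (S.atlas.W a : S.Y.Opens)) (S.atlas.preimage_eq a).le).hom).comap
    (S.i.app (S.atlas.W a)).hom)

/-- Membership in the fibre ideal, unfolded. [folklore] -/
theorem mem_fibreIdeal_iff (a : S.atlas.ι) {v : S.V} (hv : v ∈ (S.atlas.U a : S.V.Opens))
    (s : Γ(S.Y, S.atlas.W a)) :
    s ∈ S.fibreIdeal a hv ↔ (S.i.app (S.atlas.W a)).hom s ∈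
      ((S.atlas.U a).2.primeIdealOf ⟨v, hv⟩).asIdeal.map
        (S.q.appLE (S.atlas.U a) (S.i ⁻¹ᵁ (S.atlas.W a : S.Y.Opens)) (S.atlas.preimage_eq a).le).hom :=
  Ideal.mem_comap

/-- `𝓘(X)(W a) ≤ J_a(v)`: the fibre lies on `X`. [folklore] -/
theorem ker_ideal_le_fibreIdeal (a : S.atlas.ι) {v : S.V} (hv : v ∈ (S.atlas.U a : S.V.Opens)) :
    S.i.ker.ideal (S.atlas.W a) ≤ S.fibreIdeal a hv := by
  rw [Scheme.Hom.ker_apply]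
  exact Ideal.comap_mono bot_le

/-- **The fibre ideal is `𝓘(X)(W a)` plus the span of the DEGREE-ZERO sections restricting into the extension of
`𝔭(v)`** (every section of `Γ(V, U a)` is the restriction of a degree-`0` section, `GradedAtlas.exists_lift`, and
`Γ(Y, W a) → Γ(X, X ∩ W a)` is surjective with kernel `𝓘(X)(W a)`). [folklore] -/
theorem fibreIdeal_eq_span_sup_ker (a : S.atlas.ι) {v : S.V} (hv : v ∈ (S.atlas.U a : S.V.Opens)) :
    S.fibreIdeal a hv = Ideal.span {s : Γ(S.Y, S.atlas.W a) | s ∈ S.atlas.piece a 0 ∧ s ∈ S.fibreIdeal a hv} ⊔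
      S.i.ker.ideal (S.atlas.W a) := by
  set φq := (S.q.appLE (S.atlas.U a) (S.i ⁻¹ᵁ (S.atlas.W a : S.Y.Opens)) (S.atlas.preimage_eq a).le).hom
    with hφq
  set φi := (S.i.app (S.atlas.W a)).hom with hφi
  set 𝔫 := ((S.atlas.U a).2.primeIdealOf ⟨v, hv⟩).asIdeal with h𝔫
  set G : Set Γ(S.Y, S.atlas.W a) := {s | s ∈ S.atlas.piece a 0 ∧ s ∈ S.fibreIdeal a hv} with hG
  have hsurj : Function.Surjective φi := S.i.app_surjective _ (S.atlas.W a).2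
  have hmap : 𝔫.map φq = (Ideal.span G).map φi := by
    apply le_antisymm
    · rw [Ideal.map_le_iff_le_comap]
      intro c hc
      obtain ⟨s, hs0, hs⟩ := S.atlas.exists_lift a c
      have hsc : φq c = φi s := hs
      rw [Ideal.mem_comap, hsc]
      refine Ideal.mem_map_of_mem _ (Ideal.subset_span ⟨hs0, ?_⟩)
      rw [mem_fibreIdeal_iff, ← hφi, ← hsc]
      exact Ideal.mem_map_of_mem _ hc
    · rw [Ideal.map_le_iff_le_comap]
      exact Ideal.span_le.mpr fun s hs => (S.mem_fibreIdeal_iff a hv s).mp hs.2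
  have hJ : S.fibreIdeal a hv = (𝔫.map φq).comap φi := rfl
  rw [hJ, hmap, Ideal.comap_map_of_surjective _ hsurj, Scheme.Hom.ker_apply]
  rfl

/-- **The fibre ideal is homogeneous.** [folklore] -/
theorem isHomogeneous_fibreIdeal (a : S.atlas.ι) {v : S.V} (hv : v ∈ (S.atlas.U a : S.V.Opens)) :
    letI := S.atlas.gradedRing a
    (S.fibreIdeal a hv).IsHomogeneous (S.atlas.piece a) := by
  letI := S.atlas.gradedRing a
  rw [S.fibreIdeal_eq_span_sup_ker a hv]
  exact Ideal.IsHomogeneous.sup (Ideal.homogeneous_span _ _ fun s hs => ⟨0, hs.1⟩)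
    (S.atlas.isHomogeneous_ker a)

/-! ## Points of the fibre over a CLOSED point -/

/-- The prime of a point of the quotient chart at a CLOSED point of `V` is maximal. [folklore] -/
theorem isMaximal_primeIdealOf_U (a : S.atlas.ι) {v : S.V} (hv : v ∈ (S.atlas.U a : S.V.Opens))
    (hvc : IsClosed ({v} : Set S.V)) : ((S.atlas.U a).2.primeIdealOf ⟨v, hv⟩).asIdeal.IsMaximal :=
  isMaximal_primeIdealOf_of_isClosed (S.atlas.U a).2 hv hvc

/-- The prime of `i x` on `W a` is the contraction of the prime of `x` on `X ∩ W a`. [folklore] -/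
theorem comap_primeIdealOf_preimage_W (a : S.atlas.ι) {x : S.X}
    (hx : S.i.base x ∈ (S.atlas.W a : S.Y.Opens)) :
    ((S.isAffineOpen_preimage_W a).primeIdealOf ⟨x, hx⟩).asIdeal.comap (S.i.app (S.atlas.W a)).hom =
      ((S.atlas.W a).2.primeIdealOf ⟨S.i.base x, hx⟩).asIdeal := by
  have h := IsAffineOpen.comap_primeIdealOf_appLE (f := S.i) (S.atlas.W a : S.Y.Opens) (S.atlas.W a).2
    (S.i ⁻¹ᵁ (S.atlas.W a : S.Y.Opens)) (S.isAffineOpen_preimage_W a) le_rfl hx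
  rw [Scheme.Hom.appLE_eq_app] at h
  exact congrArg PrimeSpectrum.asIdeal h

/-- **Over a CLOSED point `v` of the quotient: `J_a(v) ≤ 𝔭_a(i x) ↔ q x = v`** (the points of `X ∩ W a` over
`v` are the primes of `Γ(X, X ∩ W a)` containing `𝔪_v Γ(X, X ∩ W a)`, read through the surjection from
`Γ(Y, W a)`). [folklore] -/
theorem fibreIdeal_le_primeIdealOf_iff (a : S.atlas.ι) {v : S.V} (hv : v ∈ (S.atlas.U a : S.V.Opens))
    (hvc : IsClosed ({v} : Set S.V)) {x : S.X} (hx : S.i.base x ∈ (S.atlas.W a : S.Y.Opens)) :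
    S.fibreIdeal a hv ≤ ((S.atlas.W a).2.primeIdealOf ⟨S.i.base x, hx⟩).asIdeal ↔ S.q.base x = v := by
  have hW' := S.isAffineOpen_preimage_W a
  have hx' : x ∈ S.i ⁻¹ᵁ (S.atlas.W a : S.Y.Opens) := hx
  rw [← S.comap_primeIdealOf_preimage_W a hx, fibreIdeal,
    Ideal.comap_le_comap_iff_of_surjective _ (S.i.app_surjective _ (S.atlas.W a).2),
    ← apply_fromSpec_eq_iff_map_le S.q (S.atlas.U a).2 hW' (S.atlas.preimage_eq a).le ⟨v, hv⟩
      (S.isMaximal_primeIdealOf_U a hv hvc) (hW'.primeIdealOf ⟨x, hx'⟩),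
    IsAffineOpen.fromSpec_primeIdealOf]

/-- The image of the fibre of `q` over a closed point is closed in `Y`. [folklore] -/
theorem isClosed_image_fibre {v : S.V} (hvc : IsClosed ({v} : Set S.V)) :
    IsClosed (S.i.base '' (S.q.base ⁻¹' {v})) :=
  S.i.isClosedEmbedding.isClosedMap _ (hvc.preimage S.q.base.hom.continuous)

/-- A point of `W a` at which `𝓘(X)(W a)` vanishes lies on `i(X)`. [folklore] -/
theorem mem_range_of_ker_ideal_le (a : S.atlas.ι) {y : S.Y} (hy : y ∈ (S.atlas.W a : S.Y.Opens))
    (h : S.i.ker.ideal (S.atlas.W a) ≤ ((S.atlas.W a).2.primeIdealOf ⟨y, hy⟩).asIdeal) :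
    y ∈ Set.range S.i.base := by
  have hsupp : y ∈ S.i.ker.support := by
    rw [Scheme.IdealSheafData.mem_support_iff_of_mem (U := S.atlas.W a) hy, Scheme.mem_zeroLocus_iff]
    intro f hf
    rw [mem_basicOpen_iff_not_mem_primeIdealOf (S.atlas.W a) hy f, not_not]
    exact h hf
  have hsupp' : y ∈ (S.i.ker.support : Set S.Y) := hsupp
  rwa [Scheme.Hom.support_ker, S.i.isClosedEmbedding.isClosed_range.closure_eq] at hsupp'

/-- **The trace of the fibre `i(q⁻¹{v})` on `Spec Γ(Y, W a)` is `V(J_a(v))`** (`v` closed). [folklore] -/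
theorem fromSpec_preimage_image_fibre (a : S.atlas.ι) {v : S.V} (hv : v ∈ (S.atlas.U a : S.V.Opens))
    (hvc : IsClosed ({v} : Set S.V)) :
    (S.atlas.W a).2.fromSpec ⁻¹' (S.i.base '' (S.q.base ⁻¹' {v})) =
      PrimeSpectrum.zeroLocus (S.fibreIdeal a hv) := by
  ext p
  have hy : (S.atlas.W a).2.fromSpec p ∈ (S.atlas.W a : S.Y.Opens) := fromSpec_mem _ p
  have hp : (S.atlas.W a).2.primeIdealOf ⟨(S.atlas.W a).2.fromSpec p, hy⟩ = p := primeIdealOf_fromSpec _ p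
  have hp' : p.asIdeal = ((S.atlas.W a).2.primeIdealOf ⟨(S.atlas.W a).2.fromSpec p, hy⟩).asIdeal := by
    rw [hp]
  change (S.atlas.W a).2.fromSpec p ∈ S.i.base '' (S.q.base ⁻¹' {v}) ↔
    ((S.fibreIdeal a hv : Set Γ(S.Y, S.atlas.W a)) ⊆ (p.asIdeal : Set Γ(S.Y, S.atlas.W a)))
  rw [SetLike.coe_subset_coe, hp']
  constructor
  · rintro ⟨x, hxv, hxy⟩
    have hx : S.i.base x ∈ (S.atlas.W a : S.Y.Opens) := hxy ▸ hy
    have hle := (S.fibreIdeal_le_primeIdealOf_iff a hv hvc hx).mpr hxv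
    have heq : (⟨S.i.base x, hx⟩ : (S.atlas.W a : S.Y.Opens)) = ⟨(S.atlas.W a).2.fromSpec p, hy⟩ :=
      Subtype.ext hxy
    rw [heq] at hle
    exact hle
  · intro hle
    have hle' : S.fibreIdeal a hv ≤ ((S.atlas.W a).2.primeIdealOf ⟨(S.atlas.W a).2.fromSpec p, hy⟩).asIdeal :=
      hle
    obtain ⟨x, hx⟩ := S.mem_range_of_ker_ideal_le a hy ((S.ker_ideal_le_fibreIdeal a hv).trans hle')
    have hxW : S.i.base x ∈ (S.atlas.W a : S.Y.Opens) := hx ▸ hy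
    have heq : (⟨(S.atlas.W a).2.fromSpec p, hy⟩ : (S.atlas.W a : S.Y.Opens)) = ⟨S.i.base x, hxW⟩ :=
      Subtype.ext hx.symm
    rw [heq] at hle'
    exact ⟨x, (S.fibreIdeal_le_primeIdealOf_iff a hv hvc hxW).mp hle', hx⟩

/-- **The prime of a MAXIMAL point of the fibre over a closed point is a minimal prime of the fibre ideal.**
[folklore] -/
theorem primeIdealOf_mem_minimalPrimes_fibreIdeal (a : S.atlas.ι) {v : S.V}
    (hv : v ∈ (S.atlas.U a : S.V.Opens)) (hvc : IsClosed ({v} : Set S.V)) {η : S.Y}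
    (hηW : η ∈ (S.atlas.W a : S.Y.Opens)) (hη : η ∈ maxPoints (S.i.base '' (S.q.base ⁻¹' {v}))) :
    ((S.atlas.W a).2.primeIdealOf ⟨η, hηW⟩).asIdeal ∈ (S.fibreIdeal a hv).minimalPrimes := by
  have h := primeIdealOf_mem_minimalPrimes_of_mem_maxPoints (S.atlas.W a).2 (S.isClosed_image_fibre hvc) hη hηW
  convert h using 1
  rw [← Ideal.radical_minimalPrimes (I := S.fibreIdeal a hv), ← PrimeSpectrum.vanishingIdeal_zeroLocus_eq_radical,
    ← S.fromSpec_preimage_image_fibre a hv hvc]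
  rfl

/-- **… hence HOMOGENEOUS, on EVERY chart of the atlas** (minimal primes over a homogeneous ideal of a
`ℤʲ`-graded ring are homogeneous, `Theorems.isHomogeneous_of_mem_minimalPrimes`). [folklore] -/
theorem isHomogeneous_primeIdealOf_of_mem_maxPoints_fibre (a : S.atlas.ι) {v : S.V}
    (hv : v ∈ (S.atlas.U a : S.V.Opens)) (hvc : IsClosed ({v} : Set S.V)) {η : S.Y}
    (hηW : η ∈ (S.atlas.W a : S.Y.Opens)) (hη : η ∈ maxPoints (S.i.base '' (S.q.base ⁻¹' {v}))) :
    letI := S.atlas.gradedRing a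
    (((S.atlas.W a).2.primeIdealOf ⟨η, hηW⟩).asIdeal).IsHomogeneous (S.atlas.piece a) := by
  letI := S.atlas.gradedRing a
  exact isHomogeneous_of_mem_minimalPrimes (S.atlas.piece a) (S.isHomogeneous_fibreIdeal a hv)
    (S.primeIdealOf_mem_minimalPrimes_fibreIdeal a hv hvc hηW hη)

/-! ## Graded-simplicity over the fibre ideal on a unit chart -/

/-- **Degree-`0` sections off a proper ideal `P ⊇ J_a(v)` are units modulo `P`** (`v` closed): a degree-`0`
section `s` descends to `c ∈ Γ(V, U a)` (`exists_preimage`); `s ∉ P` forces `c ∉ 𝔪_v`, so `c c' ≡ 1 (mod 𝔪_v)`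
for some `c'`, whose degree-`0` lift `s'` (`exists_lift`) satisfies `s s' - 1 ∈ J_a(v) ⊆ P`. [folklore] -/
theorem isUnit_quotient_mk_of_degreeZero_of_fibreIdeal_le (a : S.atlas.ι) {v : S.V}
    (hv : v ∈ (S.atlas.U a : S.V.Opens)) (hvc : IsClosed ({v} : Set S.V)) {P : Ideal Γ(S.Y, S.atlas.W a)}
    (hJP : S.fibreIdeal a hv ≤ P) {s : Γ(S.Y, S.atlas.W a)} (hs0 : s ∈ S.atlas.piece a 0) (hsP : s ∉ P) :
    IsUnit (Ideal.Quotient.mk P s) := by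
  letI := S.atlas.gradedRing a
  set φq := (S.q.appLE (S.atlas.U a) (S.i ⁻¹ᵁ (S.atlas.W a : S.Y.Opens)) (S.atlas.preimage_eq a).le).hom
    with hφq
  set φi := (S.i.app (S.atlas.W a)).hom with hφi
  have h𝔫 := S.isMaximal_primeIdealOf_U a hv hvc
  obtain ⟨c, hc⟩ := S.atlas.exists_preimage a s hs0
  have hsc : φq c = φi s := hc
  have hc𝔫 : c ∉ ((S.atlas.U a).2.primeIdealOf ⟨v, hv⟩).asIdeal := by
    intro h
    apply hsP
    apply hJP
    rw [mem_fibreIdeal_iff, ← hφi, ← hsc]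
    exact Ideal.mem_map_of_mem _ h
  obtain ⟨c', m, hm, hcm⟩ := h𝔫.exists_inv hc𝔫
  obtain ⟨s', hs'0, hs'⟩ := S.atlas.exists_lift a c'
  have hsc' : φq c' = φi s' := hs'
  refine isUnit_quotient_mk_of_exists_degreeZero_inverse (𝒜 := S.atlas.piece a) ⟨s', hs'0, hJP ?_⟩
  rw [mem_fibreIdeal_iff, ← hφi, map_sub, map_mul, map_one, ← hsc, ← hsc', ← map_mul]
  have h1 : c * c' = 1 - m := by linear_combination hcm
  rw [h1, map_sub, map_one, sub_sub_cancel_left]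
  exact neg_mem (Ideal.mem_map_of_mem _ hm)

/-! ## Orbit-genericity of the maximal points of the fibres over closed points -/

/-- **A maximal point of the fibre of `q` over a CLOSED point of `V` is ORBIT-GENERIC**: on every unit chart
through it its prime is homogeneous (a minimal prime of the homogeneous fibre ideal) with graded-simple
quotient (degree-`0` classes off the prime are units because `𝔪_v` is maximal; units of every degree `e • χ`
from the unit chart; res-type-047's `gradedSimple_of_degreeZero_of_units`). [folklore] -/
theorem isOrbitGeneric_of_mem_maxPoints_fibre {v : S.V} (hvc : IsClosed ({v} : Set S.V)) {η : S.Y}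
    (hη : η ∈ maxPoints (S.i.base '' (S.q.base ⁻¹' {v}))) : S.IsOrbitGeneric η := by
  intro a ha hηW
  letI := S.atlas.gradedRing a
  obtain ⟨x, hxv, hxη⟩ := maxPoints_subset _ hη
  have hηX : η ∈ Set.range S.i.base := ⟨x, hxη⟩
  have hxW : S.i.base x ∈ (S.atlas.W a : S.Y.Opens) := hxη ▸ hηW
  have hv : v ∈ (S.atlas.U a : S.V.Opens) := by
    have h := S.base_mem_U a hxW
    rwa [show S.q.base x = v from hxv] at h
  haveI : (((S.atlas.W a).2.primeIdealOf ⟨η, hηW⟩).asIdeal).IsPrime :=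
    ((S.atlas.W a).2.primeIdealOf ⟨η, hηW⟩).2
  have hmin := S.primeIdealOf_mem_minimalPrimes_fibreIdeal a hv hvc hηW hη
  refine ⟨S.isHomogeneous_primeIdealOf_of_mem_maxPoints_fibre a hv hvc hηW hη, ?_⟩
  have h0 : ∀ ⦃s : Γ(S.Y, S.atlas.W a)⦄, s ∈ S.atlas.piece a 0 →
      s ∉ ((S.atlas.W a).2.primeIdealOf ⟨η, hηW⟩).asIdeal →
      IsUnit (Ideal.Quotient.mk ((S.atlas.W a).2.primeIdealOf ⟨η, hηW⟩).asIdeal s) :=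
    fun s hs0 hsP => S.isUnit_quotient_mk_of_degreeZero_of_fibreIdeal_le a hv hvc hmin.1.2 hs0 hsP
  have hgs := gradedSimple_of_degreeZero_of_units (S.atlas.piece a) h0
    (Nat.pos_iff_ne_zero.mp S.atlas.exponent_pos)
    (fun χ => S.exists_isUnit_quotient_of_isUnitChart ha hηW hηX χ)
  exact fun d y hy hyP => hgs d hy hyP

end Summit.ResolutionOfSingularities.ResolutionOfSingularities.Theorems.ELadderOne.Stage

end
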